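import Literature.Computability.Complexity.GaussIntegralFP
import Literature.Computability.Cryptography.PolyTimeComputablePowerSeries
import Mathlib.Analysis.SpecialFunctions.Trigonometric.Series
import Mathlib.Analysis.SpecialFunctions.Trigonometric.Bounds
import HarnessLib

/-!
# `cos(2π/2ᵐ)`, `sin(2π/2ᵐ)` to any dyadic precision in polynomial time

Topic `Computability/Complexity`, sequel of `MachinPiFP.lean` (`π` to `p` bits) and `GaussIntegralFP.lean`
(`codeFP_natFactorial`). A uniform machine that prints the textbook QFT circuit over Clifford+`T`
(`QuantumComplexity/QFTQubits*.lean`: the controlled phases `R_m = diag(1, e^{2πi/2ᵐ})` of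
Nielsen–Chuang 2010, Fig. 5.1, realised by the phase gadgets of `PhaseGadgetAssemblyGen.lean`) must write,
into the gadgets' sign programs, integers `ĉ, ŝ ≤ 2ᵏ` with `ĉ/2ᵏ ≈ cos(2π/2ᵐ)`, `ŝ/2ᵏ ≈ sin(2π/2ᵐ)` to
accuracy `2⁻ᵏ` — the description printer's only contact with transcendental numbers. This file provides
them (alternating Taylor series of `cos`, `sin` on `[0, 1]`, whose truncation error is the first omitted
term; the angle with `π̃ = MachinPi.piApprox` in place of `π`, `cos`/`sin` being `1`-Lipschitz):

* `TrigDyadic.cosTaylor K x`, `sinTaylor K x` (exact rationals at rational `x`) with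
  **`abs_cos_sub_cosTaylor_le`**, **`abs_sin_sub_sinTaylor_le`**: error `≤ 1/(2K)!` resp. `≤ 1/(2K+1)!`
  for `0 ≤ x ≤ 1` (Mathlib's `Real.hasSum_cos/sin` and `alternating_series_error_bound`);
* `TrigDyadic.angleQ m p = 2·piApprox p/2ᵐ` and the exact values for `m ≤ 2`;
  `TrigDyadic.cosApprox m k`, `sinApprox m k ∈ ℚ` with **`abs_cos_sub_cosApprox_le`**,
  **`abs_sin_sub_sinApprox_le`**: `|cos(2π/2ᵐ) − cosApprox m k| ≤ 2⁻ᵏ`, likewise for `sin`, all `m`;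
* the dyadic integers `TrigDyadic.cosDyadic m k = round(2ᵏ·cosApprox m (k+1))`, `sinDyadic`, with
  `|cos(2π/2ᵐ) − cosDyadic m k/2ᵏ| ≤ 2⁻ᵏ` (`abs_cos_sub_cosDyadic_div_le`, `abs_sin_sub_sinDyadic_div_le`);
* **polynomial time** in the unary `m`, `k` (typed `CodeFP`; rational powers by the tree's
  `Cryptography.PowerSeriesFP.ratPow`): `codeFP_cosTaylor`, `codeFP_sinTaylor`, `codeFP_cosApprox`,
  `codeFP_sinApprox`, `codeFP_cosDyadic`, `codeFP_sinDyadic`.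

Everything here is proved; definitions have bodies; no named fact is introduced.

## References

* M. A. Nielsen, I. L. Chuang, *Quantum Computation and Quantum Information*, CUP 2010, §5.1 Fig. 5.1
  (the controlled-`R_k` gates), §4.5.3 (accuracy of approximating gates) [NielsenChuang2010].
* M. Abramowitz, I. A. Stegun, *Handbook of Mathematical Functions*, NBS 1964, 4.3.65–4.3.66 (Maclaurin
  series of `sin`, `cos`) [AbramowitzStegun1964].
* K.-I. Ko, *Complexity Theory of Real Functions*, Birkhäuser 1991, §2 [Ko1991].
-/

noncomputable section

namespace Literature.Computability.Complexity

open _root_.Computability Finset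
open Literature.Algebra.EuclideanLattices (encodeRat)

namespace TrigDyadic

/-! ### The Taylor polynomials and their truncation errors -/

/-- The unsigned cosine term `x^{2i}/(2i)!`. [cite: AbramowitzStegun1964, 4.3.66] -/
def cosTerm (x : ℝ) (i : ℕ) : ℝ := x ^ (2 * i) / (2 * i).factorial

/-- The unsigned sine term `x^{2i+1}/(2i+1)!`. [cite: AbramowitzStegun1964, 4.3.65] -/
def sinTerm (x : ℝ) (i : ℕ) : ℝ := x ^ (2 * i + 1) / (2 * i + 1).factorial

/-- The cosine terms are nonnegative for `x ≥ 0`. [folklore] -/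
theorem cosTerm_nonneg {x : ℝ} (hx : 0 ≤ x) (i : ℕ) : 0 ≤ cosTerm x i := by unfold cosTerm; positivity

/-- The sine terms are nonnegative for `x ≥ 0`. [folklore] -/
theorem sinTerm_nonneg {x : ℝ} (hx : 0 ≤ x) (i : ℕ) : 0 ≤ sinTerm x i := by unfold sinTerm; positivity

/-- For `0 ≤ x ≤ 1` the cosine terms decrease. [folklore] -/
theorem antitone_cosTerm {x : ℝ} (hx : 0 ≤ x) (hx1 : x ≤ 1) : Antitone (cosTerm x) := by
  refine antitone_nat_of_succ_le fun i => ?_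
  unfold cosTerm
  have h1 : x ^ (2 * (i + 1)) ≤ x ^ (2 * i) := pow_le_pow_of_le_one hx hx1 (by omega)
  have h2 : ((2 * i).factorial : ℝ) ≤ ((2 * (i + 1)).factorial : ℝ) := by
    exact_mod_cast Nat.factorial_le (by omega)
  have h3 : (0 : ℝ) < (2 * i).factorial := by positivity
  calc x ^ (2 * (i + 1)) / ((2 * (i + 1)).factorial : ℝ) ≤ x ^ (2 * i) / ((2 * (i + 1)).factorial : ℝ) := by gcongr
    _ ≤ x ^ (2 * i) / ((2 * i).factorial : ℝ) := by gcongr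

/-- For `0 ≤ x ≤ 1` the sine terms decrease. [folklore] -/
theorem antitone_sinTerm {x : ℝ} (hx : 0 ≤ x) (hx1 : x ≤ 1) : Antitone (sinTerm x) := by
  refine antitone_nat_of_succ_le fun i => ?_
  unfold sinTerm
  have h1 : x ^ (2 * (i + 1) + 1) ≤ x ^ (2 * i + 1) := pow_le_pow_of_le_one hx hx1 (by omega)
  have h2 : ((2 * i + 1).factorial : ℝ) ≤ ((2 * (i + 1) + 1).factorial : ℝ) := by
    exact_mod_cast Nat.factorial_le (by omega)
  have h3 : (0 : ℝ) < (2 * i + 1).factorial := by positivity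
  calc x ^ (2 * (i + 1) + 1) / ((2 * (i + 1) + 1).factorial : ℝ) ≤ x ^ (2 * i + 1) / ((2 * (i + 1) + 1).factorial : ℝ) := by gcongr
    _ ≤ x ^ (2 * i + 1) / ((2 * i + 1).factorial : ℝ) := by gcongr

/-- The cosine terms are summable (dominated by `1/i!` for `0 ≤ x ≤ 1`). [folklore] -/
theorem summable_cosTerm {x : ℝ} (hx : 0 ≤ x) (hx1 : x ≤ 1) : Summable (cosTerm x) := by
  refine Summable.of_nonneg_of_le (cosTerm_nonneg hx) (fun i => ?_) (Real.summable_pow_div_factorial 1)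
  unfold cosTerm
  rw [one_pow]
  have h1 : x ^ (2 * i) ≤ 1 := pow_le_one₀ hx hx1
  have h2 : ((i.factorial : ℕ) : ℝ) ≤ ((2 * i).factorial : ℝ) := by exact_mod_cast Nat.factorial_le (by omega)
  have h3 : (0 : ℝ) < i.factorial := by positivity
  calc x ^ (2 * i) / ((2 * i).factorial : ℝ) ≤ 1 / ((2 * i).factorial : ℝ) := by gcongr
    _ ≤ 1 / (i.factorial : ℝ) := by gcongr

/-- The sine terms are summable. [folklore] -/
theorem summable_sinTerm {x : ℝ} (hx : 0 ≤ x) (hx1 : x ≤ 1) : Summable (sinTerm x) := by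
  refine Summable.of_nonneg_of_le (sinTerm_nonneg hx) (fun i => ?_) (Real.summable_pow_div_factorial 1)
  unfold sinTerm
  rw [one_pow]
  have h1 : x ^ (2 * i + 1) ≤ 1 := pow_le_one₀ hx hx1
  have h2 : ((i.factorial : ℕ) : ℝ) ≤ ((2 * i + 1).factorial : ℝ) := by exact_mod_cast Nat.factorial_le (by omega)
  have h3 : (0 : ℝ) < i.factorial := by positivity
  calc x ^ (2 * i + 1) / ((2 * i + 1).factorial : ℝ) ≤ 1 / ((2 * i + 1).factorial : ℝ) := by gcongr
    _ ≤ 1 / (i.factorial : ℝ) := by gcongr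

/-- **The Taylor polynomial of `cos`** with `K` terms at a rational point, an exact rational. [cite: AbramowitzStegun1964, 4.3.66] -/
def cosTaylor (K : ℕ) (x : ℚ) : ℚ :=
  ((List.range K).map fun i => (((-1 : ℤ) ^ i : ℤ) : ℚ) * x ^ (2 * i) / (((2 * i).factorial : ℕ) : ℚ)).sum

/-- **The Taylor polynomial of `sin`** with `K` terms at a rational point. [cite: AbramowitzStegun1964, 4.3.65] -/
def sinTaylor (K : ℕ) (x : ℚ) : ℚ :=
  ((List.range K).map fun i => (((-1 : ℤ) ^ i : ℤ) : ℚ) * x ^ (2 * i + 1) / (((2 * i + 1).factorial : ℕ) : ℚ)).sum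

/-- The rational Taylor polynomial of `cos` is the alternating partial sum. [folklore] -/
theorem cast_cosTaylor (K : ℕ) (x : ℚ) : ((cosTaylor K x : ℚ) : ℝ) = ∑ i ∈ range K, (-1) ^ i * cosTerm (x : ℝ) i := by
  unfold cosTaylor cosTerm
  induction K with
  | zero => simp
  | succ K ih =>
    rw [List.range_succ, List.map_append, List.sum_append, List.map_singleton, List.sum_singleton, Rat.cast_add, ih,
      sum_range_succ]
    push_cast; ring

/-- The rational Taylor polynomial of `sin` is the alternating partial sum. [folklore] -/
theorem cast_sinTaylor (K : ℕ) (x : ℚ) : ((sinTaylor K x : ℚ) : ℝ) = ∑ i ∈ range K, (-1) ^ i * sinTerm (x : ℝ) i := by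
  unfold sinTaylor sinTerm
  induction K with
  | zero => simp
  | succ K ih =>
    rw [List.range_succ, List.map_append, List.sum_append, List.map_singleton, List.sum_singleton, Rat.cast_add, ih,
      sum_range_succ]
    push_cast; ring

/-- **`|cos x − cosTaylor K x| ≤ 1/(2K)!`** for `0 ≤ x ≤ 1`. [cite: AbramowitzStegun1964, 4.3.66] -/
theorem abs_cos_sub_cosTaylor_le (K : ℕ) {x : ℚ} (hx : 0 ≤ x) (hx1 : x ≤ 1) :
    |Real.cos x - (cosTaylor K x : ℝ)| ≤ 1 / ((2 * K).factorial : ℝ) := by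
  have hxR : (0 : ℝ) ≤ x := by exact_mod_cast hx
  have hx1R : (x : ℝ) ≤ 1 := by exact_mod_cast hx1
  have hsum : HasSum (fun i => (-1) ^ i * cosTerm (x : ℝ) i) (Real.cos x) := by
    refine (Real.hasSum_cos (x : ℝ)).congr_fun fun i => ?_
    unfold cosTerm; rw [mul_div_assoc]
  have h := alternating_series_error_bound (cosTerm (x : ℝ)) (antitone_cosTerm hxR hx1R) (summable_cosTerm hxR hx1R) K
  rw [← hsum.tsum_eq, cast_cosTaylor]
  refine h.trans ?_
  unfold cosTerm
  gcongr
  exact pow_le_one₀ hxR hx1R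

/-- **`|sin x − sinTaylor K x| ≤ 1/(2K+1)!`** for `0 ≤ x ≤ 1`. [cite: AbramowitzStegun1964, 4.3.65] -/
theorem abs_sin_sub_sinTaylor_le (K : ℕ) {x : ℚ} (hx : 0 ≤ x) (hx1 : x ≤ 1) :
    |Real.sin x - (sinTaylor K x : ℝ)| ≤ 1 / ((2 * K + 1).factorial : ℝ) := by
  have hxR : (0 : ℝ) ≤ x := by exact_mod_cast hx
  have hx1R : (x : ℝ) ≤ 1 := by exact_mod_cast hx1
  have hsum : HasSum (fun i => (-1) ^ i * sinTerm (x : ℝ) i) (Real.sin x) := by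
    refine (Real.hasSum_sin (x : ℝ)).congr_fun fun i => ?_
    unfold sinTerm; rw [mul_div_assoc]
  have h := alternating_series_error_bound (sinTerm (x : ℝ)) (antitone_sinTerm hxR hx1R) (summable_sinTerm hxR hx1R) K
  rw [← hsum.tsum_eq, cast_sinTaylor]
  refine h.trans ?_
  unfold sinTerm
  gcongr
  exact pow_le_one₀ hxR hx1R

/-! ### The angle `2π/2ᵐ` -/

open MachinPi

/-- **The rational stand-in for the angle `2π/2ᵐ`** at precision `p`: `2·piApprox p/2ᵐ`. [cite: NielsenChuang2010, §5.1 Fig. 5.1] -/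
def angleQ (m p : ℕ) : ℚ := 2 * piApprox p / 2 ^ m

/-- The stand-in is `2⁻ᵖ/2ᵐ`-close to the angle. [folklore] -/
theorem abs_angle_sub_angleQ_le (m p : ℕ) : |2 * Real.pi / 2 ^ m - (angleQ m p : ℝ)| ≤ 1 / ((2 : ℝ) ^ p * 2 ^ m) := by
  unfold angleQ
  push_cast
  have h := abs_pi_sub_piApprox_le p
  have h2m : (0 : ℝ) < 2 ^ m := by positivity
  rw [show 2 * Real.pi / 2 ^ m - 2 * (piApprox p : ℝ) / 2 ^ m = (2 / 2 ^ m) * (Real.pi - piApprox p) by ring, abs_mul,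
    abs_of_pos (by positivity)]
  calc 2 / 2 ^ m * |Real.pi - (piApprox p : ℝ)| ≤ 2 / 2 ^ m * (1 / (2 * 2 ^ p)) := by gcongr
    _ = 1 / ((2 : ℝ) ^ p * 2 ^ m) := by field_simp

/-- For `m ≥ 3` the stand-in lies in `[0, 1]` (`π̃ ≤ 4`). [folklore] -/
theorem angleQ_mem {m : ℕ} (hm : 3 ≤ m) (p : ℕ) : 0 ≤ angleQ m p ∧ angleQ m p ≤ 1 := by
  obtain ⟨h3, h4⟩ := GaussIntegral.piApprox_mem p
  have hpos : (0 : ℝ) ≤ piApprox p := by linarith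
  have h8 : (8 : ℝ) ≤ 2 ^ m := by
    calc (8 : ℝ) = 2 ^ 3 := by norm_num
      _ ≤ 2 ^ m := pow_le_pow_right₀ (by norm_num) hm
  constructor
  · have : (0 : ℝ) ≤ (angleQ m p : ℝ) := by unfold angleQ; push_cast; positivity
    exact_mod_cast this
  · have : ((angleQ m p : ℚ) : ℝ) ≤ 1 := by
      unfold angleQ; push_cast
      rw [div_le_one (by positivity)]; linarith
    exact_mod_cast this

/-- **The rational approximation of `cos(2π/2ᵐ)`** at precision `k`: exact for `m ≤ 2`, the Taylor value
with `k + 2` terms at the stand-in angle of precision `k + 1` otherwise. [cite: NielsenChuang2010, §5.1 Fig. 5.1] -/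
def cosApprox (m k : ℕ) : ℚ :=
  if m = 0 then 1 else if m = 1 then -1 else if m = 2 then 0 else cosTaylor (k + 2) (angleQ m (k + 1))

/-- **The rational approximation of `sin(2π/2ᵐ)`** at precision `k`. [cite: NielsenChuang2010, §5.1 Fig. 5.1] -/
def sinApprox (m k : ℕ) : ℚ :=
  if m = 0 then 0 else if m = 1 then 0 else if m = 2 then 1 else sinTaylor (k + 2) (angleQ m (k + 1))

/-- `(2(k+2))! ≥ 2^{k+1}` and `(2(k+2)+1)! ≥ 2^{k+1}` — the Taylor tail is below half the budget. [folklore] -/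
theorem two_pow_succ_le_factorial (k : ℕ) : (2 : ℝ) ^ (k + 1) ≤ ((2 * (k + 2)).factorial : ℝ) := by
  have h : ∀ n : ℕ, 2 ^ n ≤ (n + 1).factorial := by
    intro n
    induction n with
    | zero => simp
    | succ n ih =>
      rw [pow_succ, Nat.factorial_succ]
      calc 2 ^ n * 2 ≤ (n + 1).factorial * 2 := Nat.mul_le_mul_right _ ih
        _ ≤ (n + 1 + 1) * (n + 1).factorial := by nlinarith [Nat.factorial_pos (n + 1)]
  have h1 : (2 : ℕ) ^ (k + 1) ≤ (2 * (k + 2)).factorial := (h (k + 1)).trans (Nat.factorial_le (by omega))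
  exact_mod_cast h1

/-- **`|cos(2π/2ᵐ) − cosApprox m k| ≤ 2⁻ᵏ`.** [cite: NielsenChuang2010, §4.5.3] [cite: AbramowitzStegun1964, 4.3.66] -/
theorem abs_cos_sub_cosApprox_le (m k : ℕ) : |Real.cos (2 * Real.pi / 2 ^ m) - (cosApprox m k : ℝ)| ≤ 1 / (2 : ℝ) ^ k := by
  unfold cosApprox
  have h2k : (0 : ℝ) < 2 ^ k := by positivity
  by_cases h0 : m = 0
  · subst h0; simp
  by_cases h1 : m = 1
  · subst h1
    rw [if_neg one_ne_zero, if_pos rfl, pow_one, mul_div_cancel_left₀ _ two_ne_zero, Real.cos_pi]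
    simp
  by_cases h2 : m = 2
  · subst h2
    rw [if_neg two_ne_zero, if_neg (by norm_num), if_pos rfl,
      show (2 * Real.pi / 2 ^ 2 : ℝ) = Real.pi / 2 by ring, Real.cos_pi_div_two]
    simp
  rw [if_neg h0, if_neg h1, if_neg h2]
  have hm : 3 ≤ m := by omega
  obtain ⟨hq0, hq1⟩ := angleQ_mem hm (k + 1)
  have hT := abs_cos_sub_cosTaylor_le (k + 2) hq0 hq1
  have hA := abs_angle_sub_angleQ_le m (k + 1)
  have hL := Real.abs_cos_sub_cos_le (2 * Real.pi / 2 ^ m) (angleQ m (k + 1))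
  have hfac := two_pow_succ_le_factorial k
  have h2m : (1 : ℝ) ≤ 2 ^ m := one_le_pow₀ (by norm_num)
  calc |Real.cos (2 * Real.pi / 2 ^ m) - (cosTaylor (k + 2) (angleQ m (k + 1)) : ℝ)|
      = |(Real.cos (2 * Real.pi / 2 ^ m) - Real.cos (angleQ m (k + 1))) + (Real.cos (angleQ m (k + 1)) - cosTaylor (k + 2) (angleQ m (k + 1)))| := by
        ring_nf
    _ ≤ |Real.cos (2 * Real.pi / 2 ^ m) - Real.cos (angleQ m (k + 1))| + |Real.cos (angleQ m (k + 1)) - cosTaylor (k + 2) (angleQ m (k + 1))| :=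
        abs_add_le _ _
    _ ≤ 1 / ((2 : ℝ) ^ (k + 1) * 2 ^ m) + 1 / ((2 * (k + 2)).factorial : ℝ) := add_le_add (hL.trans hA) hT
    _ ≤ 1 / (2 : ℝ) ^ (k + 1) + 1 / (2 : ℝ) ^ (k + 1) := by
        gcongr
        · calc (2 : ℝ) ^ (k + 1) = 2 ^ (k + 1) * 1 := (mul_one _).symm
            _ ≤ 2 ^ (k + 1) * 2 ^ m := by gcongr
    _ = 1 / (2 : ℝ) ^ k := by rw [pow_succ]; field_simp; ring

/-- **`|sin(2π/2ᵐ) − sinApprox m k| ≤ 2⁻ᵏ`.** [cite: NielsenChuang2010, §4.5.3] [cite: AbramowitzStegun1964, 4.3.65] -/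
theorem abs_sin_sub_sinApprox_le (m k : ℕ) : |Real.sin (2 * Real.pi / 2 ^ m) - (sinApprox m k : ℝ)| ≤ 1 / (2 : ℝ) ^ k := by
  unfold sinApprox
  have h2k : (0 : ℝ) < 2 ^ k := by positivity
  by_cases h0 : m = 0
  · subst h0
    rw [if_pos rfl, pow_zero, div_one, Real.sin_two_pi]; simp
  by_cases h1 : m = 1
  · subst h1
    rw [if_neg one_ne_zero, if_pos rfl, pow_one, mul_div_cancel_left₀ _ two_ne_zero, Real.sin_pi]; simp
  by_cases h2 : m = 2
  · subst h2
    rw [if_neg two_ne_zero, if_neg (by norm_num), if_pos rfl,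
      show (2 * Real.pi / 2 ^ 2 : ℝ) = Real.pi / 2 by ring, Real.sin_pi_div_two]; simp
  rw [if_neg h0, if_neg h1, if_neg h2]
  have hm : 3 ≤ m := by omega
  obtain ⟨hq0, hq1⟩ := angleQ_mem hm (k + 1)
  have hT := abs_sin_sub_sinTaylor_le (k + 2) hq0 hq1
  have hA := abs_angle_sub_angleQ_le m (k + 1)
  have hL := Real.abs_sin_sub_sin_le (2 * Real.pi / 2 ^ m) (angleQ m (k + 1))
  have hfac : (2 : ℝ) ^ (k + 1) ≤ ((2 * (k + 2) + 1).factorial : ℝ) :=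
    (two_pow_succ_le_factorial k).trans (by exact_mod_cast Nat.factorial_le (by omega))
  have h2m : (1 : ℝ) ≤ 2 ^ m := one_le_pow₀ (by norm_num)
  calc |Real.sin (2 * Real.pi / 2 ^ m) - (sinTaylor (k + 2) (angleQ m (k + 1)) : ℝ)|
      = |(Real.sin (2 * Real.pi / 2 ^ m) - Real.sin (angleQ m (k + 1))) + (Real.sin (angleQ m (k + 1)) - sinTaylor (k + 2) (angleQ m (k + 1)))| := by
        ring_nf
    _ ≤ |Real.sin (2 * Real.pi / 2 ^ m) - Real.sin (angleQ m (k + 1))| + |Real.sin (angleQ m (k + 1)) - sinTaylor (k + 2) (angleQ m (k + 1))| :=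
        abs_add_le _ _
    _ ≤ 1 / ((2 : ℝ) ^ (k + 1) * 2 ^ m) + 1 / ((2 * (k + 2) + 1).factorial : ℝ) := add_le_add (hL.trans hA) hT
    _ ≤ 1 / (2 : ℝ) ^ (k + 1) + 1 / (2 : ℝ) ^ (k + 1) := by
        gcongr
        · calc (2 : ℝ) ^ (k + 1) = 2 ^ (k + 1) * 1 := (mul_one _).symm
            _ ≤ 2 ^ (k + 1) * 2 ^ m := by gcongr
    _ = 1 / (2 : ℝ) ^ k := by rw [pow_succ]; field_simp; ring

/-! ### The dyadic integers -/

/-- **The dyadic integer for `cos(2π/2ᵐ)`**: `round(2ᵏ · cosApprox m (k+1))`. [cite: Ko1991, §2] -/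
def cosDyadic (m k : ℕ) : ℤ := round ((((2 : ℕ) ^ k : ℕ) : ℤ) / ((1 : ℕ) : ℚ) * cosApprox m (k + 1))

/-- **The dyadic integer for `sin(2π/2ᵐ)`**: `round(2ᵏ · sinApprox m (k+1))`. [cite: Ko1991, §2] -/
def sinDyadic (m k : ℕ) : ℤ := round ((((2 : ℕ) ^ k : ℕ) : ℤ) / ((1 : ℕ) : ℚ) * sinApprox m (k + 1))

/-- Rounding a `2^{-(k+1)}`-accurate rational to the grid `2⁻ᵏℤ` gives a `2⁻ᵏ`-accurate dyadic. [cite: Ko1991, §2] -/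
theorem abs_sub_round_div_le {t : ℝ} {q : ℚ} {k : ℕ} (h : |t - (q : ℝ)| ≤ 1 / ((2 : ℝ) ^ k * 2)) :
    |t - (round ((((2 : ℕ) ^ k : ℕ) : ℤ) / ((1 : ℕ) : ℚ) * q) : ℝ) / (2 : ℝ) ^ k| ≤ 1 / (2 : ℝ) ^ k := by
  have h2 : (0 : ℝ) < 2 ^ k := by positivity
  have hcast : ((((2 : ℕ) ^ k : ℕ) : ℤ) / ((1 : ℕ) : ℚ) * q) = (2 : ℚ) ^ k * q := by push_cast; ring
  rw [hcast]
  have hround : |((2 : ℚ) ^ k * q : ℚ) - (round ((2 : ℚ) ^ k * q) : ℚ)| ≤ 1 / 2 := abs_sub_round _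
  have hroundR : |(2 : ℝ) ^ k * (q : ℝ) - ((round ((2 : ℚ) ^ k * q) : ℤ) : ℝ)| ≤ 1 / 2 := by
    have := (Rat.cast_le (K := ℝ)).2 hround
    push_cast at this
    exact this
  have hsplit : t - ((round ((2 : ℚ) ^ k * q) : ℤ) : ℝ) / (2 : ℝ) ^ k =
      (t - (q : ℝ)) + ((2 : ℝ) ^ k * (q : ℝ) - ((round ((2 : ℚ) ^ k * q) : ℤ) : ℝ)) / (2 : ℝ) ^ k := by
    field_simp; ring
  rw [hsplit]
  calc |t - (q : ℝ) + ((2 : ℝ) ^ k * (q : ℝ) - ((round ((2 : ℚ) ^ k * q) : ℤ) : ℝ)) / (2 : ℝ) ^ k|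
      ≤ |t - (q : ℝ)| + |((2 : ℝ) ^ k * (q : ℝ) - ((round ((2 : ℚ) ^ k * q) : ℤ) : ℝ)) / (2 : ℝ) ^ k| := abs_add_le _ _
    _ ≤ 1 / ((2 : ℝ) ^ k * 2) + (1 / 2) / (2 : ℝ) ^ k := by
        gcongr
        rw [abs_div, abs_of_pos h2]
        gcongr
    _ = 1 / (2 : ℝ) ^ k := by field_simp; ring

/-- **`|cos(2π/2ᵐ) − cosDyadic m k / 2ᵏ| ≤ 2⁻ᵏ`.** [cite: NielsenChuang2010, §4.5.3] [cite: Ko1991, §2] -/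
theorem abs_cos_sub_cosDyadic_div_le (m k : ℕ) : |Real.cos (2 * Real.pi / 2 ^ m) - (cosDyadic m k : ℝ) / (2 : ℝ) ^ k| ≤ 1 / (2 : ℝ) ^ k := by
  unfold cosDyadic
  apply abs_sub_round_div_le
  have := abs_cos_sub_cosApprox_le m (k + 1)
  rwa [pow_succ] at this

/-- **`|sin(2π/2ᵐ) − sinDyadic m k / 2ᵏ| ≤ 2⁻ᵏ`.** [cite: NielsenChuang2010, §4.5.3] [cite: Ko1991, §2] -/
theorem abs_sin_sub_sinDyadic_div_le (m k : ℕ) : |Real.sin (2 * Real.pi / 2 ^ m) - (sinDyadic m k : ℝ) / (2 : ℝ) ^ k| ≤ 1 / (2 : ℝ) ^ k := by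
  unfold sinDyadic
  apply abs_sub_round_div_le
  have := abs_sin_sub_sinApprox_le m (k + 1)
  rwa [pow_succ] at this

/-! ### Polynomial time in the unary parameters -/

open CodeFP GaussIntegral

/-- The context of the term maps: `⟨1ᵂ, x⟩` (unary exponent budget, rational point). [folklore] -/
abbrev termCtxE : ℕ × ℚ → List Bool := pairE unE encodeRat

/-- **The cosine term map is polynomial time** (capped form: exponent `min 2i W`, factorial of `min 2i W`). [cite: Ko1991, §2] -/
theorem codeFP_cosTermCapped :
    CodeFP (pairE termCtxE natE) encodeRat
      (fun q => (((-1 : ℤ) ^ q.2 : ℤ) : ℚ) * q.1.2 ^ (min (2 * q.2) q.1.1) / (((min (2 * q.2) q.1.1).factorial : ℕ) : ℚ)) := by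
  have hi : CodeFP (pairE termCtxE natE) natE (fun q => q.2) := snd _ _
  have hW : CodeFP (pairE termCtxE natE) unE (fun q => q.1.1) := (fst _ _).fst'
  have hx : CodeFP (pairE termCtxE natE) encodeRat (fun q => q.1.2) := (fst _ _).snd'
  have h2i : CodeFP (pairE termCtxE natE) natE (fun q => 2 * q.2) := (natMul.comp ((const _ 2).pair hi) :)
  have heu : CodeFP (pairE termCtxE natE) unE (fun q => min (2 * q.2) q.1.1) := (unOfNatMin.comp (hW.pair h2i) :)
  have hpow : CodeFP (pairE termCtxE natE) encodeRat (fun q => q.1.2 ^ (min (2 * q.2) q.1.1)) := (Cryptography.PowerSeriesFP.ratPow.comp (hx.pair heu) :)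
  have hfac : CodeFP (pairE termCtxE natE) natE (fun q => (min (2 * q.2) q.1.1).factorial) := (codeFP_natFactorial.comp heu :)
  have hpar : CodeFP (pairE termCtxE natE) bitE (fun q => decide (q.2 % 2 = 0)) :=
    (natEq.comp ((natMod.comp (hi.pair (const _ 2))).pair (const _ 0)) :)
  have hsign : CodeFP (pairE termCtxE natE) encodeRat (fun q => (((-1 : ℤ) ^ q.2 : ℤ) : ℚ)) :=
    (hpar.ite (const _ (1 : ℚ)) (const _ (-1 : ℚ))).congr fun q => by rw [MachinPi.neg_one_pow_eq_ite]; split_ifs <;> simp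
  have hfacQ : CodeFP (pairE termCtxE natE) encodeRat (fun q => (((1 : ℤ)) : ℚ) / (((min (2 * q.2) q.1.1).factorial : ℕ) : ℚ)) :=
    (ratOfIntNat.comp ((const _ (1 : ℤ)).pair hfac) :)
  refine ((ratMul.comp ((ratMul.comp (hsign.pair hpow)).pair hfacQ)).congr fun q => ?_)
  simp only
  push_cast
  ring

/-- **The sine term map is polynomial time** (capped form). [cite: Ko1991, §2] -/
theorem codeFP_sinTermCapped :
    CodeFP (pairE termCtxE natE) encodeRat
      (fun q => (((-1 : ℤ) ^ q.2 : ℤ) : ℚ) * q.1.2 ^ (min (2 * q.2 + 1) q.1.1) / (((min (2 * q.2 + 1) q.1.1).factorial : ℕ) : ℚ)) := by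
  have hi : CodeFP (pairE termCtxE natE) natE (fun q => q.2) := snd _ _
  have hW : CodeFP (pairE termCtxE natE) unE (fun q => q.1.1) := (fst _ _).fst'
  have hx : CodeFP (pairE termCtxE natE) encodeRat (fun q => q.1.2) := (fst _ _).snd'
  have h2i : CodeFP (pairE termCtxE natE) natE (fun q => 2 * q.2 + 1) := (natAdd.comp ((natMul.comp ((const _ 2).pair hi)).pair (const _ 1)) :)
  have heu : CodeFP (pairE termCtxE natE) unE (fun q => min (2 * q.2 + 1) q.1.1) := (unOfNatMin.comp (hW.pair h2i) :)
  have hpow : CodeFP (pairE termCtxE natE) encodeRat (fun q => q.1.2 ^ (min (2 * q.2 + 1) q.1.1)) := (Cryptography.PowerSeriesFP.ratPow.comp (hx.pair heu) :)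
  have hfac : CodeFP (pairE termCtxE natE) natE (fun q => (min (2 * q.2 + 1) q.1.1).factorial) := (codeFP_natFactorial.comp heu :)
  have hpar : CodeFP (pairE termCtxE natE) bitE (fun q => decide (q.2 % 2 = 0)) :=
    (natEq.comp ((natMod.comp (hi.pair (const _ 2))).pair (const _ 0)) :)
  have hsign : CodeFP (pairE termCtxE natE) encodeRat (fun q => (((-1 : ℤ) ^ q.2 : ℤ) : ℚ)) :=
    (hpar.ite (const _ (1 : ℚ)) (const _ (-1 : ℚ))).congr fun q => by rw [MachinPi.neg_one_pow_eq_ite]; split_ifs <;> simp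
  have hfacQ : CodeFP (pairE termCtxE natE) encodeRat (fun q => (((1 : ℤ)) : ℚ) / (((min (2 * q.2 + 1) q.1.1).factorial : ℕ) : ℚ)) :=
    (ratOfIntNat.comp ((const _ (1 : ℤ)).pair hfac) :)
  refine ((ratMul.comp ((ratMul.comp (hsign.pair hpow)).pair hfacQ)).congr fun q => ?_)
  simp only
  push_cast
  ring

/-- **`⟨1ᴷ, x⟩ ↦ cosTaylor K x` is polynomial time.** [cite: Ko1991, §2] -/
theorem codeFP_cosTaylor : CodeFP (pairE unE encodeRat) encodeRat (fun p => cosTaylor p.1 p.2) := by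
  have hK : CodeFP (pairE unE encodeRat) unE (fun p => p.1) := fst _ _
  have hW : CodeFP (pairE unE encodeRat) unE (fun p => 2 * p.1 + 1) := (unSucc.comp (unAdd.comp (hK.pair hK))).congr fun p => by simp; ring
  have hctx : CodeFP (pairE unE encodeRat) termCtxE (fun p => (2 * p.1 + 1, p.2)) := (hW.pair (snd _ _) :)
  have hmap := (map codeFP_cosTermCapped).comp (hctx.pair (urange.comp hK))
  refine ((ratSum.comp hmap).congr fun p => ?_)
  unfold cosTaylor
  congr 1
  refine List.map_congr_left fun i hi => ?_
  rw [List.mem_range] at hi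
  simp only
  rw [min_eq_left (by omega)]

/-- **`⟨1ᴷ, x⟩ ↦ sinTaylor K x` is polynomial time.** [cite: Ko1991, §2] -/
theorem codeFP_sinTaylor : CodeFP (pairE unE encodeRat) encodeRat (fun p => sinTaylor p.1 p.2) := by
  have hK : CodeFP (pairE unE encodeRat) unE (fun p => p.1) := fst _ _
  have hW : CodeFP (pairE unE encodeRat) unE (fun p => 2 * p.1 + 1) := (unSucc.comp (unAdd.comp (hK.pair hK))).congr fun p => by simp; ring
  have hctx : CodeFP (pairE unE encodeRat) termCtxE (fun p => (2 * p.1 + 1, p.2)) := (hW.pair (snd _ _) :)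
  have hmap := (map codeFP_sinTermCapped).comp (hctx.pair (urange.comp hK))
  refine ((ratSum.comp hmap).congr fun p => ?_)
  unfold sinTaylor
  congr 1
  refine List.map_congr_left fun i hi => ?_
  rw [List.mem_range] at hi
  simp only
  rw [min_eq_left (by omega)]

/-- `⟨1ᵐ, 1ᵖ⟩ ↦ angleQ m p` is polynomial time. [cite: Ko1991, §2] -/
theorem codeFP_angleQ : CodeFP (pairE unE unE) encodeRat (fun p => angleQ p.1 p.2) := by
  have h2m : CodeFP (pairE unE unE) encodeRat (fun p => ((((2 : ℕ) ^ p.1 : ℕ) : ℤ) : ℚ) / ((1 : ℕ) : ℚ)) :=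
    (ratOfIntNat.comp ((intOfNat.comp (natPow.comp ((const _ 2).pair (fst _ _)))).pair (const _ 1)) :)
  have hpi : CodeFP (pairE unE unE) encodeRat (fun p => piApprox p.2) := (MachinPi.codeFP_piApprox.comp (snd _ _) :)
  refine ((ratDiv.comp ((ratMul.comp ((const _ (2 : ℚ)).pair hpi)).pair h2m)).congr fun p => ?_)
  unfold angleQ; simp only; push_cast; ring

/-- A unary test `m = c` on codes. [folklore] -/
theorem codeFP_unEqConst (c : ℕ) : CodeFP unE bitE (fun m => decide (m = c)) :=
  (natEq.comp (natOfUn.pair (const _ c)) :)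

/-- **`⟨1ᵐ, 1ᵏ⟩ ↦ cosApprox m k` is polynomial time.** [cite: Ko1991, §2] -/
theorem codeFP_cosApprox : CodeFP (pairE unE unE) encodeRat (fun p => cosApprox p.1 p.2) := by
  have hm : CodeFP (pairE unE unE) unE (fun p => p.1) := fst _ _
  have hk : CodeFP (pairE unE unE) unE (fun p => p.2) := snd _ _
  have hT : CodeFP (pairE unE unE) encodeRat (fun p => cosTaylor (p.2 + 2) (angleQ p.1 (p.2 + 1))) :=
    (codeFP_cosTaylor.comp ((unSucc.comp (unSucc.comp hk)).pair (codeFP_angleQ.comp (hm.pair (unSucc.comp hk)))) :)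
  have h2 := ((codeFP_unEqConst 2).comp hm).ite (const _ (0 : ℚ)) hT
  have h1 := ((codeFP_unEqConst 1).comp hm).ite (const _ (-1 : ℚ)) h2
  have h0 := ((codeFP_unEqConst 0).comp hm).ite (const _ (1 : ℚ)) h1
  refine h0.congr fun p => ?_
  unfold cosApprox
  simp only [decide_eq_true_eq]

/-- **`⟨1ᵐ, 1ᵏ⟩ ↦ sinApprox m k` is polynomial time.** [cite: Ko1991, §2] -/
theorem codeFP_sinApprox : CodeFP (pairE unE unE) encodeRat (fun p => sinApprox p.1 p.2) := by
  have hm : CodeFP (pairE unE unE) unE (fun p => p.1) := fst _ _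
  have hk : CodeFP (pairE unE unE) unE (fun p => p.2) := snd _ _
  have hT : CodeFP (pairE unE unE) encodeRat (fun p => sinTaylor (p.2 + 2) (angleQ p.1 (p.2 + 1))) :=
    (codeFP_sinTaylor.comp ((unSucc.comp (unSucc.comp hk)).pair (codeFP_angleQ.comp (hm.pair (unSucc.comp hk)))) :)
  have h2 := ((codeFP_unEqConst 2).comp hm).ite (const _ (1 : ℚ)) hT
  have h1 := ((codeFP_unEqConst 1).comp hm).ite (const _ (0 : ℚ)) h2
  have h0 := ((codeFP_unEqConst 0).comp hm).ite (const _ (0 : ℚ)) h1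
  refine h0.congr fun p => ?_
  unfold sinApprox
  simp only [decide_eq_true_eq]

/-- **`⟨1ᵐ, 1ᵏ⟩ ↦ cosDyadic m k` is polynomial time.** [cite: Ko1991, §2] -/
theorem codeFP_cosDyadic : CodeFP (pairE unE unE) intE (fun p => cosDyadic p.1 p.2) := by
  have h2k : CodeFP (pairE unE unE) encodeRat (fun p => ((((2 : ℕ) ^ p.2 : ℕ) : ℤ) : ℚ) / ((1 : ℕ) : ℚ)) :=
    (ratOfIntNat.comp ((intOfNat.comp (natPow.comp ((const _ 2).pair (snd _ _)))).pair (const _ 1)) :)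
  have hc : CodeFP (pairE unE unE) encodeRat (fun p => cosApprox p.1 (p.2 + 1)) := (codeFP_cosApprox.comp ((fst _ _).pair (unSucc.comp (snd _ _))) :)
  exact (ratRound.comp (ratMul.comp (h2k.pair hc))).congr fun _ => rfl

/-- **`⟨1ᵐ, 1ᵏ⟩ ↦ sinDyadic m k` is polynomial time.** [cite: Ko1991, §2] -/
theorem codeFP_sinDyadic : CodeFP (pairE unE unE) intE (fun p => sinDyadic p.1 p.2) := by
  have h2k : CodeFP (pairE unE unE) encodeRat (fun p => ((((2 : ℕ) ^ p.2 : ℕ) : ℤ) : ℚ) / ((1 : ℕ) : ℚ)) :=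
    (ratOfIntNat.comp ((intOfNat.comp (natPow.comp ((const _ 2).pair (snd _ _)))).pair (const _ 1)) :)
  have hs : CodeFP (pairE unE unE) encodeRat (fun p => sinApprox p.1 (p.2 + 1)) := (codeFP_sinApprox.comp ((fst _ _).pair (unSucc.comp (snd _ _))) :)
  exact (ratRound.comp (ratMul.comp (h2k.pair hs))).congr fun _ => rfl

end TrigDyadic

end Literature.Computability.Complexity

end
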